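import Mathlib.Analysis.InnerProductSpace.PiL2
import Mathlib.Analysis.Matrix.PosDef
import HarnessLib

/-!
# Stationary Euler as a differential inclusion: the state space, `𝒦_r`, the relaxed hull and
the wave cone (Choffrut–Székelyhidi 2014, §2–§3)

Topic `Literature/Analysis/FluidPDE`. First support file of the proof of
`Literature.Analysis.FluidPDE.Torus.ChoffrutSzekelyhidi2014_thm1`
(`StationaryEulerHPrinciple.lean`; Choffrut–Székelyhidi, SIAM J. Math. Anal. 46 (2014) =
arXiv:1401.4301, Thm. 1). It fixes the finite-dimensional bookkeeping of §2–§3 of the paper for a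
general finite index type `d` (the space dimension is `Fintype.card d`):

* the state space `ℝ^d × ℝ^{d×d}` of pairs `w = (v, u)` (velocity, traceless stress), realised as
  the Euclidean space `State d = EuclideanSpace ℝ (d ⊕ d × d)` with the projections `vel w : ℝ^d`,
  `str w : Matrix d d ℝ` and the constructor `mkSt v u`; admissible states `IsAdm w`
  (`u` symmetric and trace free, the paper's `𝒮^d_0`);
* the constraint set `K r = {(v, v ⊗ v - (r/d) Id) : |v|² = r}` (paper, (2.3)), the matrix
  `gap r w = u - v ⊗ v + (r/d) Id` and the closed set `C r = {w adm : gap r w ⪰ 0}` — by the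
  formula (2.5) of the paper (De Lellis–Székelyhidi 2010, Lemma 3) `C r` is the convex hull
  `K_r^{co}`; here only the elementary facts are needed and proved: `K r ⊆ C r`, `C r` is closed
  (jointly in `(r, w)`), bounded (`|v|² ≤ r`, `|u_{ij}| ≤ 3r`), and a point of `C r` with
  `|v|² = r` lies in `K r` ("a useful consequence of this formula", paper p. 4);
* the wave cone: `IsWaveDir a` iff there are `η ≠ 0` and `q` with `v̄ · η = 0` and
  `(ū + q Id) η = 0` (paper, (3.1)). **Deviation:** the paper requires `v̄ ≠ 0` in (3.1); we do
  not, since the localized plane waves of Lemma 3 exist verbatim for directions `(0, ū)` with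
  `η` an eigenvector of `ū` (the potentials of `StationaryEulerPotentials.lean` cover them), and
  a larger cone only enlarges the class of laminates.

## References

* A. Choffrut, L. Székelyhidi Jr., *Weak solutions to the stationary incompressible Euler
  equations*, SIAM J. Math. Anal. 46 (2014) 4060–4074, §2 (Lemma 2, (2.3)–(2.6)), §3 ((3.1)).
* C. De Lellis, L. Székelyhidi Jr., *On admissibility criteria for weak solutions of the Euler
  equations*, Arch. Ration. Mech. Anal. 195 (2010), Lemma 3 (the formula for `K_r^{co}`).
-/

noncomputable section

open scoped InnerProductSpace Matrix

namespace Literature.Analysis.FluidPDE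

namespace StationaryEuler

variable {d : Type*} [Fintype d] [DecidableEq d]

/-! ## The state space -/

variable (d) in
/-- Coordinate indices of a state `(v, u)`: `inl i` is the velocity component `vᵢ`, `inr (i, j)`
the stress entry `uᵢⱼ`. [folklore] -/
abbrev Idx : Type _ := d ⊕ d × d

variable (d) in
/-- The state space `ℝ^d × ℝ^{d × d}` of the stationary Euler differential inclusion, as a
Euclidean space (so that `‖w‖² = |v|² + Σᵢⱼ uᵢⱼ²`). The paper's state space `ℝ^d × 𝒮^d_0` is the
subspace of admissible states `IsAdm`. [cite: ChoffrutSzekelyhidi2014, §2] -/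
abbrev State : Type _ := EuclideanSpace ℝ (Idx d)

/-- The velocity component `v ∈ ℝ^d` of a state. [cite: ChoffrutSzekelyhidi2014, §2] -/
def vel (w : State d) : EuclideanSpace ℝ d := WithLp.toLp 2 fun i => w (Sum.inl i)

/-- The stress component `u ∈ ℝ^{d×d}` of a state. [cite: ChoffrutSzekelyhidi2014, §2] -/
def str (w : State d) : Matrix d d ℝ := Matrix.of fun i j => w (Sum.inr (i, j))

/-- The state with velocity `v` and stress `u`. [cite: ChoffrutSzekelyhidi2014, §2] -/
def mkSt (v : EuclideanSpace ℝ d) (u : Matrix d d ℝ) : State d :=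
  WithLp.toLp 2 (Sum.elim (fun i => v i) fun p : d × d => u p.1 p.2)

omit [Fintype d] [DecidableEq d] in
/-- Components of the velocity projection. [folklore] -/
@[simp] theorem vel_apply (w : State d) (i : d) : vel w i = w (Sum.inl i) := rfl

omit [Fintype d] [DecidableEq d] in
/-- Entries of the stress projection. [folklore] -/
@[simp] theorem str_apply (w : State d) (i j : d) : str w i j = w (Sum.inr (i, j)) := rfl

omit [Fintype d] [DecidableEq d] in
/-- Velocity coordinates of `mkSt v u`. [folklore] -/
@[simp] theorem mkSt_apply_inl (v : EuclideanSpace ℝ d) (u : Matrix d d ℝ) (i : d) :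
    mkSt v u (Sum.inl i) = v i := rfl

omit [Fintype d] [DecidableEq d] in
/-- Stress coordinates of `mkSt v u`. [folklore] -/
@[simp] theorem mkSt_apply_inr (v : EuclideanSpace ℝ d) (u : Matrix d d ℝ) (p : d × d) :
    mkSt v u (Sum.inr p) = u p.1 p.2 := rfl

omit [Fintype d] [DecidableEq d] in
/-- `vel (mkSt v u) = v`. [folklore] -/
@[simp] theorem vel_mkSt (v : EuclideanSpace ℝ d) (u : Matrix d d ℝ) : vel (mkSt v u) = v := by
  ext i; rfl

omit [Fintype d] [DecidableEq d] in
/-- `str (mkSt v u) = u`. [folklore] -/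
@[simp] theorem str_mkSt (v : EuclideanSpace ℝ d) (u : Matrix d d ℝ) : str (mkSt v u) = u := by
  ext i j; rfl

omit [Fintype d] [DecidableEq d] in
/-- A state is determined by its velocity and stress. [folklore] -/
@[simp] theorem mkSt_vel_str (w : State d) : mkSt (vel w) (str w) = w := by
  ext c; rcases c with i | ⟨i, j⟩ <;> rfl

omit [Fintype d] [DecidableEq d] in
/-- Extensionality through the two components. [folklore] -/
theorem ext_vel_str {w w' : State d} (hv : vel w = vel w') (hu : str w = str w') : w = w' := by
  rw [← mkSt_vel_str w, ← mkSt_vel_str w', hv, hu]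

omit [Fintype d] [DecidableEq d] in
/-- `vel` is additive. [folklore] -/
@[simp] theorem vel_add (w w' : State d) : vel (w + w') = vel w + vel w' := by ext i; rfl
omit [Fintype d] [DecidableEq d] in
/-- `vel` commutes with subtraction. [folklore] -/
@[simp] theorem vel_sub (w w' : State d) : vel (w - w') = vel w - vel w' := by ext i; rfl
omit [Fintype d] [DecidableEq d] in
/-- `vel` is homogeneous. [folklore] -/
@[simp] theorem vel_smul (c : ℝ) (w : State d) : vel (c • w) = c • vel w := by ext i; rfl
omit [Fintype d] [DecidableEq d] in
/-- `vel 0 = 0`. [folklore] -/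
@[simp] theorem vel_zero : vel (0 : State d) = 0 := by ext i; rfl
omit [Fintype d] [DecidableEq d] in
/-- `vel` commutes with negation. [folklore] -/
@[simp] theorem vel_neg (w : State d) : vel (-w) = -vel w := by ext i; rfl
omit [Fintype d] [DecidableEq d] in
/-- `str` is additive. [folklore] -/
@[simp] theorem str_add (w w' : State d) : str (w + w') = str w + str w' := by ext i j; rfl
omit [Fintype d] [DecidableEq d] in
/-- `str` commutes with subtraction. [folklore] -/
@[simp] theorem str_sub (w w' : State d) : str (w - w') = str w - str w' := by ext i j; rfl
omit [Fintype d] [DecidableEq d] in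
/-- `str` is homogeneous. [folklore] -/
@[simp] theorem str_smul (c : ℝ) (w : State d) : str (c • w) = c • str w := by ext i j; rfl
omit [Fintype d] [DecidableEq d] in
/-- `str 0 = 0`. [folklore] -/
@[simp] theorem str_zero : str (0 : State d) = 0 := by ext i j; rfl
omit [Fintype d] [DecidableEq d] in
/-- `str` commutes with negation. [folklore] -/
@[simp] theorem str_neg (w : State d) : str (-w) = -str w := by ext i j; rfl
omit [Fintype d] [DecidableEq d] in
/-- `mkSt` is additive. [folklore] -/
@[simp] theorem mkSt_add (v v' : EuclideanSpace ℝ d) (u u' : Matrix d d ℝ) :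
    mkSt v u + mkSt v' u' = mkSt (v + v') (u + u') := by
  ext c; rcases c with i | ⟨i, j⟩ <;> rfl
omit [Fintype d] [DecidableEq d] in
/-- `mkSt` commutes with subtraction. [folklore] -/
@[simp] theorem mkSt_sub (v v' : EuclideanSpace ℝ d) (u u' : Matrix d d ℝ) :
    mkSt v u - mkSt v' u' = mkSt (v - v') (u - u') := by
  ext c; rcases c with i | ⟨i, j⟩ <;> rfl
omit [Fintype d] [DecidableEq d] in
/-- `mkSt` is homogeneous. [folklore] -/
@[simp] theorem smul_mkSt (c : ℝ) (v : EuclideanSpace ℝ d) (u : Matrix d d ℝ) :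
    c • mkSt v u = mkSt (c • v) (c • u) := by
  ext k; rcases k with i | ⟨i, j⟩ <;> rfl

omit [Fintype d] [DecidableEq d] in
/-- `vel` commutes with finite sums. [folklore] -/
theorem vel_sum {ι : Type*} (s : Finset ι) (f : ι → State d) :
    vel (∑ k ∈ s, f k) = ∑ k ∈ s, vel (f k) := by
  classical
  induction s using Finset.induction_on with
  | empty => simp
  | insert a s ha ih => rw [Finset.sum_insert ha, Finset.sum_insert ha, vel_add, ih]

omit [Fintype d] [DecidableEq d] in
/-- `str` commutes with finite sums. [folklore] -/
theorem str_sum {ι : Type*} (s : Finset ι) (f : ι → State d) :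
    str (∑ k ∈ s, f k) = ∑ k ∈ s, str (f k) := by
  classical
  induction s using Finset.induction_on with
  | empty => simp
  | insert a s ha ih => rw [Finset.sum_insert ha, Finset.sum_insert ha, str_add, ih]

omit [DecidableEq d] in
/-- `‖w‖² = |v|² + Σᵢⱼ uᵢⱼ²`. [folklore] -/
theorem norm_sq_eq (w : State d) : ‖w‖ ^ 2 = ‖vel w‖ ^ 2 + ∑ i, ∑ j, str w i j ^ 2 := by
  rw [EuclideanSpace.norm_sq_eq, EuclideanSpace.norm_sq_eq, Fintype.sum_sum_type,
    Fintype.sum_prod_type]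
  simp [Real.norm_eq_abs, sq_abs]

omit [DecidableEq d] in
/-- `|v| ≤ ‖w‖`. [folklore] -/
theorem norm_vel_le (w : State d) : ‖vel w‖ ≤ ‖w‖ :=
  le_of_sq_le_sq (by rw [norm_sq_eq]; exact le_add_of_nonneg_right (by positivity))
    (norm_nonneg _)

omit [DecidableEq d] in
/-- `|uᵢⱼ| ≤ ‖w‖`. [folklore] -/
theorem abs_str_le_norm (w : State d) (i j : d) : |str w i j| ≤ ‖w‖ := by
  have h : |w (Sum.inr (i, j))| ≤ ‖w‖ := by
    simpa [Real.norm_eq_abs] using PiLp.norm_apply_le (p := 2) w (Sum.inr (i, j))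
  simpa using h

omit [Fintype d] [DecidableEq d] in
/-- The velocity projection is continuous. [folklore] -/
theorem continuous_vel : Continuous (vel : State d → EuclideanSpace ℝ d) := by
  unfold vel; fun_prop

omit [Fintype d] [DecidableEq d] in
/-- Each stress entry is a continuous function of the state. [folklore] -/
theorem continuous_str_apply (i j : d) : Continuous fun w : State d => str w i j := by
  simp only [str_apply]; fun_prop

/-! ## Admissible states, the constraint set `K_r` and the relaxed set `C_r` -/

/-- Admissible states: the stress is symmetric and trace free (`u ∈ 𝒮^d_0`).
[cite: ChoffrutSzekelyhidi2014, §2] -/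
def IsAdm (w : State d) : Prop := (str w).IsSymm ∧ (str w).trace = 0

omit [DecidableEq d] in
/-- Admissible states form a subspace: sums. [folklore] -/
theorem IsAdm.add {w w' : State d} (hw : IsAdm w) (hw' : IsAdm w') : IsAdm (w + w') :=
  ⟨by rw [str_add]; exact hw.1.add hw'.1, by rw [str_add, Matrix.trace_add, hw.2, hw'.2, add_zero]⟩

omit [DecidableEq d] in
/-- Admissible states form a subspace: scalar multiples. [folklore] -/
theorem IsAdm.smul {w : State d} (hw : IsAdm w) (c : ℝ) : IsAdm (c • w) :=
  ⟨by rw [str_smul]; exact hw.1.smul c, by rw [str_smul, Matrix.trace_smul, hw.2, smul_zero]⟩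

omit [DecidableEq d] in
/-- Admissible states form a subspace: negatives. [folklore] -/
theorem IsAdm.neg {w : State d} (hw : IsAdm w) : IsAdm (-w) := by
  simpa using hw.smul (-1)

omit [DecidableEq d] in
/-- Admissible states form a subspace: differences. [folklore] -/
theorem IsAdm.sub {w w' : State d} (hw : IsAdm w) (hw' : IsAdm w') : IsAdm (w - w') := by
  simpa [sub_eq_add_neg] using hw.add hw'.neg

omit [DecidableEq d] in
/-- `0` is admissible. [folklore] -/
theorem isAdm_zero : IsAdm (0 : State d) := ⟨by rw [str_zero]; exact Matrix.isSymm_zero, by simp⟩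

/-- The tensor `v ⊗ v` as a matrix. [folklore] -/
abbrev tensorSelf (v : EuclideanSpace ℝ d) : Matrix d d ℝ := Matrix.vecMulVec (⇑v) (⇑v)

omit [DecidableEq d] in
/-- `tr (v ⊗ v) = |v|²`. [folklore] -/
theorem trace_tensorSelf (v : EuclideanSpace ℝ d) : (tensorSelf v).trace = ‖v‖ ^ 2 := by
  rw [Matrix.trace_vecMulVec, EuclideanSpace.norm_sq_eq]
  simp [dotProduct, Real.norm_eq_abs, sq]

omit [Fintype d] [DecidableEq d] in
/-- `v ⊗ v` is symmetric. [folklore] -/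
theorem tensorSelf_isSymm (v : EuclideanSpace ℝ d) : (tensorSelf v).IsSymm := by
  unfold Matrix.IsSymm; ext i j; simp [Matrix.vecMulVec_apply, mul_comm]

/-- The constraint set `𝒦_r = {(v, u) : u = v ⊗ v - (r/d) Id, |v|² = r}` ((2.3) of the paper;
for `|v|² = r` the stress `v ⊗ v - (r/d) Id` is automatically trace free).
[cite: ChoffrutSzekelyhidi2014, (2.3)] -/
def K (r : ℝ) : Set (State d) :=
  {w | ‖vel w‖ ^ 2 = r ∧ str w = tensorSelf (vel w) - (r / Fintype.card d) • (1 : Matrix d d ℝ)}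

/-- The matrix `(r/d) Id - (v ⊗ v - u) = u - v ⊗ v + (r/d) Id`, whose positive semidefiniteness
describes the convex hull `𝒦_r^{co}` ((2.5) of the paper). [cite: ChoffrutSzekelyhidi2014, (2.5)] -/
def gap (r : ℝ) (w : State d) : Matrix d d ℝ :=
  str w - tensorSelf (vel w) + (r / Fintype.card d) • (1 : Matrix d d ℝ)

/-- The relaxed set `{(v, u) ∈ ℝ^d × 𝒮^d_0 : v ⊗ v - u ≤ (r/d) Id}`; by De Lellis–Székelyhidi
2010, Lemma 3, this is the convex hull `𝒦_r^{co}` ((2.5) of the paper), but only the defining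
inequality is used here. [cite: ChoffrutSzekelyhidi2014, (2.5)] -/
def C (r : ℝ) : Set (State d) := {w | IsAdm w ∧ (gap r w).PosSemidef}

omit [DecidableEq d] in
/-- Membership in `𝒦_r`. [cite: ChoffrutSzekelyhidi2014, (2.3)] -/
theorem mem_K_iff {r : ℝ} {w : State d} [DecidableEq d] :
    w ∈ K r ↔ ‖vel w‖ ^ 2 = r ∧
      str w = tensorSelf (vel w) - (r / Fintype.card d) • (1 : Matrix d d ℝ) := Iff.rfl

/-- On `𝒦_r` the gap matrix vanishes. [folklore] -/
theorem gap_eq_zero_of_mem_K {r : ℝ} {w : State d} (hw : w ∈ K r) : gap r w = 0 := by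
  rw [gap, hw.2]; abel

/-- The gap matrix of a state with symmetric stress is symmetric. [folklore] -/
theorem gap_isSymm {r : ℝ} {w : State d} (hw : (str w).IsSymm) : (gap r w).IsSymm :=
  ((hw.sub (tensorSelf_isSymm _)).add (Matrix.isSymm_one.smul _))

variable [Nonempty d]

omit [DecidableEq d] in
/-- `0 < d` as a real number. [folklore] -/
private theorem card_pos' : (0 : ℝ) < Fintype.card d := by exact_mod_cast Fintype.card_pos

/-- `tr (gap r w) = r - |v|²` for admissible `w`. [cite: ChoffrutSzekelyhidi2014, §2] -/
theorem trace_gap {r : ℝ} {w : State d} (hw : IsAdm w) : (gap r w).trace = r - ‖vel w‖ ^ 2 := by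
  rw [gap, Matrix.trace_add, Matrix.trace_sub, hw.2, trace_tensorSelf, Matrix.trace_smul,
    Matrix.trace_one, smul_eq_mul, div_mul_cancel₀ _ card_pos'.ne']
  ring

/-- States of `𝒦_r` are admissible. [cite: ChoffrutSzekelyhidi2014, §2] -/
theorem isAdm_of_mem_K {r : ℝ} {w : State d} (hw : w ∈ K r) : IsAdm w := by
  refine ⟨?_, ?_⟩
  · rw [hw.2]; exact (tensorSelf_isSymm _).sub (Matrix.isSymm_one.smul _)
  · rw [hw.2, Matrix.trace_sub, trace_tensorSelf, Matrix.trace_smul, Matrix.trace_one, smul_eq_mul,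
      div_mul_cancel₀ _ card_pos'.ne', hw.1, sub_self]

/-- `𝒦_r ⊆ 𝒦_r^{co}`. [cite: ChoffrutSzekelyhidi2014, (2.5)] -/
theorem K_subset_C (r : ℝ) : K r ⊆ (C r : Set (State d)) := fun w hw =>
  ⟨isAdm_of_mem_K hw, by rw [gap_eq_zero_of_mem_K hw]; exact Matrix.PosSemidef.zero⟩

omit [Nonempty d] in
/-- The state `(v, v ⊗ v - (|v|²/d) Id)` attached to a velocity lies in `𝒦_{|v|²}` (Step 2 of the
proof of Thm. 1, p. 5: `w₀(x) ∈ 𝒦_{|v₀|²(x)}`). [cite: ChoffrutSzekelyhidi2014, §2, Step 2] -/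
theorem mkSt_mem_K (v : EuclideanSpace ℝ d) :
    mkSt v (tensorSelf v - (‖v‖ ^ 2 / Fintype.card d) • (1 : Matrix d d ℝ)) ∈ K (‖v‖ ^ 2) := by
  simp [K]

/-! ## Elementary properties of `C_r` -/

omit [Nonempty d] [DecidableEq d] in
/-- A quadratic form written as a double sum. [folklore] -/
theorem dotProduct_mulVec_eq_sum (N : Matrix d d ℝ) (x : d → ℝ) :
    x ⬝ᵥ (N *ᵥ x) = ∑ i, ∑ j, x i * N i j * x j := by
  simp only [dotProduct, Matrix.mulVec, Finset.mul_sum, mul_assoc]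

omit [Nonempty d] in
/-- The entries of the gap matrix depend continuously on `(r, w)`. [folklore] -/
theorem continuous_gap_apply (i j : d) : Continuous fun p : ℝ × State d => gap p.1 p.2 i j := by
  simp only [gap, Matrix.add_apply, Matrix.sub_apply, Matrix.vecMulVec_apply, Matrix.smul_apply,
    str_apply, vel_apply, smul_eq_mul]
  fun_prop

omit [Nonempty d] in
/-- The quadratic form of the gap matrix:
`xᵀ (gap r w) x = xᵀ u x - (v · x)² + (r/d) |x|²`. [folklore] -/
theorem dotProduct_gap_mulVec (r : ℝ) (w : State d) (x : d → ℝ) :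
    x ⬝ᵥ (gap r w *ᵥ x) =
      x ⬝ᵥ (str w *ᵥ x) - (∑ i, vel w i * x i) ^ 2 + r / Fintype.card d * ∑ i, x i ^ 2 := by
  have h1 : x ⬝ᵥ (tensorSelf (vel w) *ᵥ x) = (∑ i, vel w i * x i) ^ 2 := by
    rw [dotProduct_mulVec_eq_sum, sq, Finset.sum_mul_sum]
    refine Finset.sum_congr rfl fun i _ => Finset.sum_congr rfl fun j _ => ?_
    simp only [Matrix.vecMulVec_apply]; ring
  have h2 : x ⬝ᵥ (((r / Fintype.card d) • (1 : Matrix d d ℝ)) *ᵥ x) =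
      r / Fintype.card d * ∑ i, x i ^ 2 := by
    rw [Matrix.smul_mulVec, Matrix.one_mulVec, dotProduct_smul, smul_eq_mul]
    simp [dotProduct, sq]
  rw [gap, Matrix.add_mulVec, Matrix.sub_mulVec, dotProduct_add, dotProduct_sub, h1, h2]

omit [Nonempty d] in
/-- Membership in `C_r` through the quadratic form of the gap matrix. [folklore] -/
theorem mem_C_iff {r : ℝ} {w : State d} :
    w ∈ C r ↔ IsAdm w ∧ ∀ x : d → ℝ, 0 ≤ x ⬝ᵥ (gap r w *ᵥ x) := by
  constructor
  · rintro ⟨ha, hp⟩; exact ⟨ha, fun x => by simpa using hp.dotProduct_mulVec_nonneg x⟩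
  · rintro ⟨ha, hp⟩
    exact ⟨ha, Matrix.PosSemidef.of_dotProduct_mulVec_nonneg
      (Matrix.isHermitian_iff_isSymm.2 (gap_isSymm ha.1)) fun x => by simpa using hp x⟩

omit [Nonempty d] in
/-- Nonnegativity of the gap form on `C_r`. [folklore] -/
theorem dotProduct_gap_mulVec_nonneg {r : ℝ} {w : State d} (hw : w ∈ C r) (x : d → ℝ) :
    0 ≤ x ⬝ᵥ (gap r w *ᵥ x) := by
  simpa using hw.2.dotProduct_mulVec_nonneg x

/-- On `𝒦_r^{co}` the velocity satisfies `|v|² ≤ r`. [cite: ChoffrutSzekelyhidi2014, §2, Step 1] -/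
theorem norm_vel_sq_le_of_mem_C {r : ℝ} {w : State d} (hw : w ∈ C r) : ‖vel w‖ ^ 2 ≤ r := by
  have h := hw.2.trace_nonneg
  rw [trace_gap hw.1] at h
  linarith

/-- `C_r` is empty for `r < 0`, i.e. `r ≥ 0` on `C_r`. [folklore] -/
theorem nonneg_of_mem_C {r : ℝ} {w : State d} (hw : w ∈ C r) : 0 ≤ r :=
  (sq_nonneg _).trans (norm_vel_sq_le_of_mem_C hw)

omit [Nonempty d] in
/-- Diagonal entries of the gap matrix are nonnegative on `C_r`. [folklore] -/
theorem gap_diag_nonneg {r : ℝ} {w : State d} (hw : w ∈ C r) (i : d) : 0 ≤ gap r w i i :=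
  hw.2.diag_nonneg

/-- Diagonal entries of the gap matrix are at most `r` on `C_r` (they are nonnegative and sum to
`r - |v|²`). [folklore] -/
theorem gap_diag_le {r : ℝ} {w : State d} (hw : w ∈ C r) (i : d) : gap r w i i ≤ r := by
  have htr := trace_gap (r := r) hw.1
  rw [Matrix.trace] at htr
  have hle : gap r w i i ≤ ∑ j, gap r w j j :=
    Finset.single_le_sum (fun j _ => gap_diag_nonneg hw j) (Finset.mem_univ i)
  simp only [Matrix.diag_apply] at htr
  nlinarith [sq_nonneg ‖vel w‖]

omit [Nonempty d] in
/-- Off-diagonal entries of a positive semidefinite real symmetric matrix are controlled by the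
diagonal: `2|Nᵢⱼ| ≤ Nᵢᵢ + Nⱼⱼ` (test vectors `eᵢ ± eⱼ`). [folklore] -/
theorem two_mul_abs_le_of_posSemidef {N : Matrix d d ℝ} (hN : N.PosSemidef) (hs : N.IsSymm)
    (i j : d) : 2 * |N i j| ≤ N i i + N j j := by
  have key : ∀ s : ℝ, 0 ≤ N i i + s * N i j + s * N j i + s * s * N j j := by
    intro s
    have h := hN.dotProduct_mulVec_nonneg (Pi.single i 1 + s • Pi.single j 1)
    simp only [star_trivial, Matrix.mulVec_add, Matrix.mulVec_smul, Matrix.mulVec_single_one,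
      add_dotProduct, dotProduct_add, smul_dotProduct, dotProduct_smul, single_one_dotProduct,
      Matrix.col_apply, smul_eq_mul] at h
    nlinarith [h]
  have hji : N j i = N i j := hs.apply i j
  have h1 := key 1
  have h2 := key (-1)
  rw [hji] at h1 h2
  have : |N i j| ≤ (N i i + N j j) / 2 := abs_le.2 ⟨by nlinarith, by nlinarith⟩
  linarith

omit [Fintype d] [DecidableEq d] [Nonempty d] in
/-- Triangle inequality for three terms. [folklore] -/
private theorem abs_add_sub_le_three (a b c : ℝ) : |a + b - c| ≤ |a| + |b| + |c| := by
  calc |a + b - c| ≤ |a + b| + |c| := abs_sub _ _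
    _ ≤ |a| + |b| + |c| := by gcongr; exact abs_add_le _ _

/-- On `𝒦_r^{co}` every stress entry is bounded: `|uᵢⱼ| ≤ 3r` (since `u = N + v ⊗ v - (r/d) Id`
with `0 ⪯ N`, `tr N ≤ r`, `|v|² ≤ r`); this is the boundedness "`|u| ≤ 2ē`" of Step 1, p. 5, up to
the constant. [cite: ChoffrutSzekelyhidi2014, §2, Step 1] -/
theorem abs_str_le_of_mem_C {r : ℝ} {w : State d} (hw : w ∈ C r) (i j : d) :
    |str w i j| ≤ 3 * r := by
  have hr := nonneg_of_mem_C hw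
  have hv := norm_vel_sq_le_of_mem_C hw
  have hN : |gap r w i j| ≤ r := by
    have := two_mul_abs_le_of_posSemidef hw.2 (gap_isSymm hw.1.1) i j
    linarith [gap_diag_le hw i, gap_diag_le hw j]
  have hvi : |vel w i| ≤ ‖vel w‖ := by
    simpa [Real.norm_eq_abs] using PiLp.norm_apply_le (p := 2) (vel w) i
  have hvj : |vel w j| ≤ ‖vel w‖ := by
    simpa [Real.norm_eq_abs] using PiLp.norm_apply_le (p := 2) (vel w) j
  have hvv : |vel w i * vel w j| ≤ r := by
    rw [abs_mul]
    calc |vel w i| * |vel w j| ≤ ‖vel w‖ * ‖vel w‖ :=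
          mul_le_mul hvi hvj (abs_nonneg _) (norm_nonneg _)
      _ = ‖vel w‖ ^ 2 := (sq _).symm
      _ ≤ r := hv
  have hone : |(r / Fintype.card d) * (1 : Matrix d d ℝ) i j| ≤ r := by
    have hc : (1 : ℝ) ≤ Fintype.card d := by exact_mod_cast Fintype.card_pos
    rcases eq_or_ne i j with rfl | hij
    · rw [Matrix.one_apply_eq, mul_one, abs_of_nonneg (by positivity)]
      exact div_le_self hr hc
    · rw [Matrix.one_apply_ne hij, mul_zero, abs_zero]; exact hr
  have hdecomp : str w i j =
      gap r w i j + vel w i * vel w j - (r / Fintype.card d) * (1 : Matrix d d ℝ) i j := by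
    simp only [gap, Matrix.sub_apply, Matrix.add_apply, Matrix.vecMulVec_apply, Matrix.smul_apply,
      smul_eq_mul]
    ring
  rw [hdecomp]
  calc |gap r w i j + vel w i * vel w j - r / ↑(Fintype.card d) * (1 : Matrix d d ℝ) i j|
      ≤ |gap r w i j| + |vel w i * vel w j| + |r / ↑(Fintype.card d) * (1 : Matrix d d ℝ) i j| :=
        abs_add_sub_le_three _ _ _
    _ ≤ r + r + r := by gcongr
    _ = 3 * r := by ring

/-- `𝒦_r^{co}` is bounded: `‖w‖ ≤ √r + 3 r d` for `w ∈ C_r`. [cite: ChoffrutSzekelyhidi2014, §2, Step 1] -/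
theorem norm_le_of_mem_C {r : ℝ} {w : State d} (hw : w ∈ C r) :
    ‖w‖ ≤ Real.sqrt r + 3 * r * Fintype.card d := by
  have hr := nonneg_of_mem_C hw
  have hv := norm_vel_sq_le_of_mem_C hw
  have hB : (0 : ℝ) ≤ 3 * r * Fintype.card d := by positivity
  have h2 : ∑ i, ∑ j, str w i j ^ 2 ≤ (3 * r * Fintype.card d) ^ 2 := by
    calc ∑ i, ∑ j, str w i j ^ 2 ≤ ∑ _i : d, ∑ _j : d, (3 * r) ^ 2 := by
          refine Finset.sum_le_sum fun i _ => Finset.sum_le_sum fun j _ => ?_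
          have h := abs_le.1 (abs_str_le_of_mem_C hw i j)
          exact sq_le_sq' h.1 h.2
      _ = (3 * r * Fintype.card d) ^ 2 := by
          simp only [Finset.sum_const, Finset.card_univ, nsmul_eq_mul]
          ring
  have h3 : ‖w‖ ^ 2 ≤ (Real.sqrt r + 3 * r * Fintype.card d) ^ 2 := by
    calc ‖w‖ ^ 2 = ‖vel w‖ ^ 2 + ∑ i, ∑ j, str w i j ^ 2 := norm_sq_eq w
      _ ≤ r + (3 * r * Fintype.card d) ^ 2 := add_le_add hv h2
      _ = Real.sqrt r ^ 2 + (3 * r * Fintype.card d) ^ 2 := by rw [Real.sq_sqrt hr]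
      _ ≤ (Real.sqrt r + 3 * r * Fintype.card d) ^ 2 := by
          nlinarith [mul_nonneg (Real.sqrt_nonneg r) hB]
  exact le_of_sq_le_sq h3 (by positivity)

/-- **"A useful consequence of (2.5)"** (paper, p. 4): a point of `𝒦_r^{co}` with `|v|² = r` lies
in `𝒦_r` (the gap matrix is positive semidefinite with trace `r - |v|² = 0`, hence vanishes).
[cite: ChoffrutSzekelyhidi2014, §2, (2.6)] -/
theorem mem_K_of_mem_C_of_norm_sq_eq {r : ℝ} {w : State d} (hw : w ∈ C r) (hv : ‖vel w‖ ^ 2 = r) :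
    w ∈ K r := by
  refine ⟨hv, ?_⟩
  have htr : (gap r w).trace = 0 := by rw [trace_gap hw.1, hv, sub_self]
  have h0 : gap r w = 0 := hw.2.trace_eq_zero_iff.1 htr
  have : str w - tensorSelf (vel w) + (r / Fintype.card d) • (1 : Matrix d d ℝ) = 0 := h0
  rw [← sub_eq_zero, ← this]; abel

omit [Nonempty d] in
/-- **Concavity of the gap form in the state**: for a convex combination `a w₁ + b w₂`,
`a · xᵀ gap(w₁) x + b · xᵀ gap(w₂) x ≤ xᵀ gap(a w₁ + b w₂) x` (the term `-(v · x)²` is concave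
in `v`, the rest is affine). [folklore] -/
theorem convexCombo_dotProduct_gap_mulVec_le (r : ℝ) (w₁ w₂ : State d) {a b : ℝ} (ha : 0 ≤ a)
    (hb : 0 ≤ b) (hab : a + b = 1) (x : d → ℝ) :
    a * (x ⬝ᵥ (gap r w₁ *ᵥ x)) + b * (x ⬝ᵥ (gap r w₂ *ᵥ x)) ≤
      x ⬝ᵥ (gap r (a • w₁ + b • w₂) *ᵥ x) := by
  rw [dotProduct_gap_mulVec, dotProduct_gap_mulVec, dotProduct_gap_mulVec]
  simp only [str_add, str_smul, vel_add, vel_smul, Matrix.add_mulVec, Matrix.smul_mulVec,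
    dotProduct_add, dotProduct_smul, smul_eq_mul, PiLp.add_apply, PiLp.smul_apply]
  have hsum : ∑ i, (a * vel w₁ i + b * vel w₂ i) * x i =
      a * ∑ i, vel w₁ i * x i + b * ∑ i, vel w₂ i * x i := by
    rw [Finset.mul_sum, Finset.mul_sum, ← Finset.sum_add_distrib]
    refine Finset.sum_congr rfl fun i _ => ?_; ring
  rw [hsum]
  set P := ∑ i, vel w₁ i * x i
  set Q := ∑ i, vel w₂ i * x i
  have hconv : (a * P + b * Q) ^ 2 ≤ a * P ^ 2 + b * Q ^ 2 := by
    have hb' : b = 1 - a := by linarith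
    subst hb'
    nlinarith [mul_nonneg (mul_nonneg ha hb) (sq_nonneg (P - Q))]
  have hsq : r / Fintype.card d * ∑ i, x i ^ 2 =
      a * (r / Fintype.card d * ∑ i, x i ^ 2) + b * (r / Fintype.card d * ∑ i, x i ^ 2) := by
    rw [← add_mul, hab, one_mul]
  nlinarith [hconv, hsq]

omit [Nonempty d] in
/-- `C_r` is convex (the gap form is concave in the state). [cite: ChoffrutSzekelyhidi2014, (2.5)] -/
theorem convex_C (r : ℝ) : Convex ℝ (C r : Set (State d)) := by
  intro w₁ h₁ w₂ h₂ a b ha hb hab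
  rw [mem_C_iff] at h₁ h₂ ⊢
  refine ⟨(h₁.1.smul a).add (h₂.1.smul b), fun x => ?_⟩
  have := convexCombo_dotProduct_gap_mulVec_le r w₁ w₂ ha hb hab x
  nlinarith [mul_nonneg ha (h₁.2 x), mul_nonneg hb (h₂.2 x)]

omit [Nonempty d] in
/-- Changing `r` shifts the gap matrix by a multiple of the identity. [folklore] -/
theorem gap_eq_gap_add (r r' : ℝ) (w : State d) :
    gap r w = gap r' w + ((r - r') / Fintype.card d) • (1 : Matrix d d ℝ) := by
  simp only [gap, sub_div, sub_smul]
  abel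

omit [Nonempty d] in
/-- The gap form changes by `((r - r')/d) |x|²` when `r'` is replaced by `r`. [folklore] -/
theorem dotProduct_gap_mulVec_eq_add (r r' : ℝ) (w : State d) (x : d → ℝ) :
    x ⬝ᵥ (gap r w *ᵥ x) = x ⬝ᵥ (gap r' w *ᵥ x) + (r - r') / Fintype.card d * ∑ i, x i ^ 2 := by
  rw [dotProduct_gap_mulVec, dotProduct_gap_mulVec]
  ring

omit [Nonempty d] in
/-- The set `{(r, w) : w ∈ C_r}` is closed in `ℝ × State`. [folklore] -/
theorem isClosed_setOf_mem_C : IsClosed {p : ℝ × State d | p.2 ∈ C p.1} := by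
  have h1 : IsClosed {p : ℝ × State d | IsAdm p.2} := by
    have : {p : ℝ × State d | IsAdm p.2} =
        (⋂ i, ⋂ j, {p | str p.2 j i = str p.2 i j}) ∩ {p | ∑ i, str p.2 i i = 0} := by
      ext p
      simp only [Set.mem_setOf_eq, IsAdm, Matrix.IsSymm, Matrix.trace, Matrix.diag_apply,
        Set.mem_inter_iff, Set.mem_iInter, ← Matrix.ext_iff, Matrix.transpose_apply]
    rw [this]
    refine (isClosed_iInter fun i => isClosed_iInter fun j => isClosed_eq ?_ ?_).inter
      (isClosed_eq ?_ continuous_const)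
    · exact (continuous_str_apply j i).comp continuous_snd
    · exact (continuous_str_apply i j).comp continuous_snd
    · exact continuous_finsetSum _ fun i _ => (continuous_str_apply i i).comp continuous_snd
  have h2 : {p : ℝ × State d | p.2 ∈ C p.1} =
      {p | IsAdm p.2} ∩ ⋂ x : d → ℝ, {p | 0 ≤ x ⬝ᵥ (gap p.1 p.2 *ᵥ x)} := by
    ext p
    simp only [Set.mem_setOf_eq, mem_C_iff, Set.mem_inter_iff, Set.mem_iInter]
  rw [h2]
  refine h1.inter (isClosed_iInter fun x => isClosed_le continuous_const ?_)
  simp only [dotProduct_mulVec_eq_sum]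
  exact continuous_finsetSum _ fun i _ => continuous_finsetSum _ fun j _ =>
    (continuous_const.mul (continuous_gap_apply i j)).mul continuous_const

omit [Nonempty d] in
/-- `C_r` is closed. [folklore] -/
theorem isClosed_C (r : ℝ) : IsClosed (C r : Set (State d)) :=
  isClosed_setOf_mem_C.preimage (Continuous.prodMk_right r)

/-! ## The wave cone -/

/-- The (enlarged) stationary wave cone: `a = (v̄, ū)` is a wave direction if for some
`η ∈ ℝ^d ∖ {0}` and `q ∈ ℝ`, `v̄ · η = 0` and `(ū + q Id) η = 0` — (3.1) of the paper, where in
addition `v̄ ≠ 0` is required (see the module docstring for why the condition is dropped).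
[cite: ChoffrutSzekelyhidi2014, (3.1)] -/
def IsWaveDir (a : State d) : Prop :=
  ∃ η : EuclideanSpace ℝ d, ∃ q : ℝ, η ≠ 0 ∧ ⟪vel a, η⟫_ℝ = 0 ∧
    (str a + q • (1 : Matrix d d ℝ)) *ᵥ (⇑η) = 0

omit [Nonempty d] in
/-- The explicit form of the wave-cone condition used to build potentials. [folklore] -/
theorem isWaveDir_iff (a : State d) : IsWaveDir a ↔
    ∃ η : EuclideanSpace ℝ d, ∃ q : ℝ, η ≠ 0 ∧ ⟪vel a, η⟫_ℝ = 0 ∧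
      (str a + q • (1 : Matrix d d ℝ)) *ᵥ (⇑η) = 0 := Iff.rfl

omit [Nonempty d] in
/-- The wave cone is symmetric. [folklore] -/
theorem IsWaveDir.neg {a : State d} (h : IsWaveDir a) : IsWaveDir (-a) := by
  obtain ⟨η, q, hη, hv, hu⟩ := h
  refine ⟨η, -q, hη, by simp [hv], ?_⟩
  have : str (-a) + (-q) • (1 : Matrix d d ℝ) = -(str a + q • 1) := by
    rw [str_neg, neg_smul, neg_add]
  rw [this, Matrix.neg_mulVec, hu, neg_zero]

omit [Nonempty d] in
/-- The wave cone is a cone. [folklore] -/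
theorem IsWaveDir.smul {a : State d} (h : IsWaveDir a) (c : ℝ) : IsWaveDir (c • a) := by
  obtain ⟨η, q, hη, hv, hu⟩ := h
  refine ⟨η, c * q, hη, by simp [inner_smul_left, hv], ?_⟩
  have : str (c • a) + (c * q) • (1 : Matrix d d ℝ) = c • (str a + q • 1) := by
    rw [str_smul, smul_add, mul_smul]
  rw [this, Matrix.smul_mulVec, hu, smul_zero]

omit [Nonempty d] in
/-- `b - a` is a wave direction iff `a - b` is. [folklore] -/
theorem isWaveDir_sub_comm {a b : State d} : IsWaveDir (a - b) ↔ IsWaveDir (b - a) := by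
  constructor <;> intro h <;> simpa using h.neg

end StationaryEuler

end Literature.Analysis.FluidPDE
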